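import Summits.Ventures.PercRepro.S1SeriesLever
import Summits.Ventures.PercRepro.RankLevelSetFourCircuitNullityFourSharp

/-!
# PercRepro — THE ITERATED SERIES-CLASS LEVER ON THE SHARP CHAIN: `gb14 d n` (p8 g8, S3; p2's S1SeriesLever re-based)

p2's `gb d n` (S1SeriesLever: on the coloop-free part of an `e`-free core of nullity `d` with `≥ n` non-coloops either a
point has `≥ 3` series partners and lies on `≤ 1` quad, or the averaged point leaves a core of nullity `d − 1` with
`≥ n − 3` non-coloops) with the chain `avgChain14` (RankLevelSetFourCircuitNullityFourSharp: `14 / 25 / 41 / 61 / 88 / …`)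
in place of `avgChain16`: `gb14 d n = avgChain14 d` at `d ≤ 4`, then `max (avgChain14 (d − 1) + 1)
⌊n'·gb14 (d − 1) (n' − 3)/(n' − 4)⌋`, `n' = max n (gbFloor d)`. The proof is p2's word for word. VALUES: **`gb14 8 33 = 62`**
(the coloop-free cell `(25, 8)` of the level-6 window needs `s₄ ≤ 66` there), `gb14 7 32 = 42`, `gb14 9 19 = 98`
(p2's `gb 9 19 = 111`), `gb14 7 18 = 42`, `gb14 6 15 = 28`, `gb14 5 9 = 25`. Axioms: standard.
-/

open scoped Matroid

namespace PercRepro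

namespace S1

open Set

variable {α : Type}

/-- **THE ITERATED SERIES-CLASS LEVER**: `gb14 d n` bounds `s₄` on every `e`-free core of nullity `d` with at least `n`
non-coloops — `avgChain14 d` at `d ≤ 4`, then the larger of `avgChain14 (d − 1) + 1` (a point with `≥ 3` series partners)
and `⌊n'·gb14 (d − 1) (n' − 3)/(n' − 4)⌋` with `n' = max n (gbFloor d)` (the averaged point). -/
def gb14 : ℕ → ℕ → ℕ
  | 0, _ => ThmN.avgChain14 0
  | 1, _ => ThmN.avgChain14 1
  | 2, _ => ThmN.avgChain14 2
  | 3, _ => ThmN.avgChain14 3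
  | 4, _ => ThmN.avgChain14 4
  | d + 5, n => max (ThmN.avgChain14 (d + 4) + 1)
      (max n (gbFloor (d + 5)) * gb14 (d + 4) (max n (gbFloor (d + 5)) - 3) / (max n (gbFloor (d + 5)) - 4))

/-- `gb14 d n = avgChain14 d` for `d ≤ 4`. -/
theorem gb14_of_le_four {d : ℕ} (hd : d ≤ 4) (n : ℕ) : gb14 d n = ThmN.avgChain14 d := by
  interval_cases d <;> rfl

/-- The unfolding of `gb14` at nullity `d + 5`. -/
theorem gb14_succ (d n : ℕ) : gb14 (d + 5) n = max (ThmN.avgChain14 (d + 4) + 1)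
    (max n (gbFloor (d + 5)) * gb14 (d + 4) (max n (gbFloor (d + 5)) - 3) / (max n (gbFloor (d + 5)) - 4)) := rfl

/-- The values `gb14 8 33 = 62`, `gb14 7 32 = 42`, `gb14 9 19 = 98`, `gb14 7 18 = 42`, `gb14 6 15 = 28`, `gb14 5 9 = 25`. -/
theorem gb14_values : gb14 8 33 = 62 ∧ gb14 7 32 = 42 ∧ gb14 9 19 = 98 ∧ gb14 7 18 = 42 ∧ gb14 6 15 = 28 ∧ gb14 5 9 = 25 := by decide

/-- **`s₄ ≤ gb14 d n` on every `e`-free core of nullity `d` with at least `n` non-coloops.** -/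
theorem ncard_fourCircuits_le_gb14 (d : ℕ) : ∀ (M : Matroid α) [M.Finite],
    (∀ e ∈ M.E, ∃ A ⊆ M.E \ {e}, e ∉ M.closure A ∧ e ∉ M.closure ((M.E \ {e}) \ A)) →
    M.E.encard = M.eRank + d → ∀ n, n ≤ (M.E \ M.coloops).ncard →
    {C : Set α | M.IsCircuit C ∧ C.ncard = 4}.ncard ≤ gb14 d n := by
  induction d with
  | zero =>
    intro M _ hfree hd n _
    rw [gb14_of_le_four (by norm_num)]
    exact ThmN.ncard_fourCircuits_le_avgChain14 0 M hfree hd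
  | succ d ih =>
    intro M _ hfree hd n hn
    rcases Nat.lt_or_ge d 4 with hd4 | hd4
    · rw [gb14_of_le_four (by omega)]
      exact ThmN.ncard_fourCircuits_le_avgChain14 (d + 1) M hfree hd
    obtain ⟨d', rfl⟩ : ∃ d', d = d' + 4 := ⟨d - 4, by omega⟩
    rw [show d' + 4 + 1 = d' + 5 by ring] at hd ⊢
    rw [gb14_succ]
    classical
    -- the coloop-free part `P`
    set P := M ＼ M.coloops with hPdef
    have hPcol : P.coloops = ∅ := coloops_delete_coloops M
    have hPfree := hfree_delete_set M hfree M.coloops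
    have hPd : P.E.encard = P.eRank + ((d' + 5 : ℕ) : ℕ∞) := encard_delete_coloops M hd
    have hPd' : P.E.encard = P.eRank + ((d' + 4 : ℕ) + 1) := by rw [hPd]; push_cast; ring
    have hPs : {C : Set α | P.IsCircuit C ∧ C.ncard = 4} = {C : Set α | M.IsCircuit C ∧ C.ncard = 4} :=
      fourCircuits_delete_coloops M
    have hPn : P.E.ncard = (M.E \ M.coloops).ncard := ncard_ground_delete_coloops M
    -- the floor on the non-coloops
    have hfloor : gbFloor (d' + 5) ≤ P.E.ncard := by
      rw [hPn]
      unfold gbFloor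
      rcases Nat.lt_or_ge d' 2 with h2 | h2
      · interval_cases d'
        · simp only [show (0 + 5 : ℕ) ≤ 6 by norm_num, if_true]
          exact card_nonColoops_ge_nine M hfree (by exact_mod_cast hd)
        · simp only [show (1 + 5 : ℕ) ≤ 6 by norm_num, if_true]
          exact card_nonColoops_ge_ten M hfree (by exact_mod_cast hd)
      · rw [if_neg (by omega)]
        have h := card_nonColoops_ge M hfree (d := d' + 4) (by rw [hd]; push_cast; ring) (by omega)
        omega
    set n' := max n (gbFloor (d' + 5)) with hn'
    have hn'P : n' ≤ P.E.ncard := by rw [hPn] at hfloor ⊢; exact max_le hn hfloor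
    have hn'9 : 9 ≤ n' := by
      have : 9 ≤ gbFloor (d' + 5) := by unfold gbFloor; split_ifs <;> omega
      exact this.trans (le_max_right _ _)
    rw [← hPs]
    by_cases hA : ∃ e ∈ P.E, 3 ≤ (P ＼ {e}).coloops.ncard
    · -- CASE A: a point with `≥ 3` series partners lies on at most one quad
      obtain ⟨e, heE, hk3⟩ := hA
      have hec : ¬ P.IsColoop e := by
        rw [Matroid.isColoop_iff_mem_coloops, hPcol]; exact Set.notMem_empty e
      have hthr : {C : Set α | P.IsCircuit C ∧ C.ncard = 4 ∧ e ∈ C}.ncard ≤ 1 := by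
        rcases Nat.lt_or_ge (P ＼ {e}).coloops.ncard 4 with hk4 | hk4
        · exact S2.ncard_fourCircuitsThrough_le_one_of_three P hPcol e (by omega)
        · rw [S2.ncard_fourCircuitsThrough_eq_zero_of_four_le P hPcol e hk4]; norm_num
      have hsplit := ncard_fourCircuits_le_through_add_delete P e
      have hde : (P ＼ {e}).E.encard = (P ＼ {e}).eRank + ((d' + 4 : ℕ) : ℕ∞) :=
        S2.delete_nullity_of_nonColoop' P hPd' heE hec
      have hrec := ThmN.ncard_fourCircuits_le_avgChain14 (d' + 4) (P ＼ {e}) (hfree_delete P hPfree e) hde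
      exact le_max_of_le_left (by omega)
    · -- CASE B: every point has `≤ 2` series partners — the averaged point `x`
      push Not at hA
      apply le_max_of_le_right
      rcases Nat.eq_zero_or_pos {C : Set α | P.IsCircuit C ∧ C.ncard = 4}.ncard with h0 | hpos
      · rw [h0]; exact Nat.zero_le _
      obtain ⟨x, hxE, -, hx⟩ := exists_nonColoop_ncard_fourCircuitsThrough_le P hpos
      have hmn : (P.ground_finite.toFinset.filter (fun y => ¬ P.IsColoop y)).card = P.E.ncard := by
        rw [Finset.filter_true_of_mem, ← Set.ncard_eq_toFinset_card _ P.ground_finite]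
        intro y _
        rw [Matroid.isColoop_iff_mem_coloops, hPcol]
        exact Set.notMem_empty y
      rw [hmn] at hx
      have hx' : {C : Set α | P.IsCircuit C ∧ C.ncard = 4 ∧ x ∈ C}.ncard ≤
          4 * {C : Set α | P.IsCircuit C ∧ C.ncard = 4}.ncard / n' :=
        hx.trans (Nat.div_le_div_left hn'P (by omega))
      -- `P ＼ {x}`: a core of nullity `d' + 4` with `≥ n' − 3` non-coloops
      have hxc : ¬ P.IsColoop x := by
        rw [Matroid.isColoop_iff_mem_coloops, hPcol]; exact Set.notMem_empty x
      have hdx : (P ＼ {x}).E.encard = (P ＼ {x}).eRank + ((d' + 4 : ℕ) : ℕ∞) :=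
        S2.delete_nullity_of_nonColoop' P hPd' hxE hxc
      have hk2 : (P ＼ {x}).coloops.ncard ≤ 2 := by have := hA x hxE; omega
      have hxn : (P ＼ {x}).E.ncard + 1 = P.E.ncard := by
        rw [_root_.Matroid.delete_ground]
        exact Set.ncard_sdiff_singleton_add_one hxE P.ground_finite
      have hnc : n' - 3 ≤ ((P ＼ {x}).E \ (P ＼ {x}).coloops).ncard := by
        have hKsub : (P ＼ {x}).coloops ⊆ (P ＼ {x}).E := (P ＼ {x}).coloops_subset_ground
        rw [Set.ncard_sdiff hKsub ((P ＼ {x}).ground_finite.subset hKsub)]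
        omega
      have hrec := ih (P ＼ {x}) (hfree_delete P hPfree x) hdx (n' - 3) hnc
      have hsplit := ncard_fourCircuits_le_through_add_delete P x
      have hsub : {C : Set α | P.IsCircuit C ∧ C.ncard = 4}.ncard -
          4 * {C : Set α | P.IsCircuit C ∧ C.ncard = 4}.ncard / n' ≤ gb14 (d' + 4) (n' - 3) := by omega
      exact le_mul_div_of_sub_div_le (by omega) hsub

/-- **The coloop-free form**: on a coloop-free `e`-free core of nullity `d` on `n` points, `s₄ ≤ gb14 d n`. -/
theorem ncard_fourCircuits_le_gb14_of_coloopFree (M : Matroid α) [M.Finite]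
    (hfree : ∀ e ∈ M.E, ∃ A ⊆ M.E \ {e}, e ∉ M.closure A ∧ e ∉ M.closure ((M.E \ {e}) \ A))
    {d : ℕ} (hd : M.E.encard = M.eRank + d) (hcol : M.coloops = ∅) {n : ℕ} (hn : M.E.ncard = n) :
    {C : Set α | M.IsCircuit C ∧ C.ncard = 4}.ncard ≤ gb14 d n :=
  ncard_fourCircuits_le_gb14 d M hfree hd n (by rw [hcol, Set.sdiff_empty, hn])

end S1

end PercRepro
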